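/-
COR-CM (cell pub-hodgecm2, stage 2 of the Hodge ladder) — Δ2 BRIDGE, sub-socket S-e «CONJUGATE REST AT δ′», TRANSPORT route: K1 DISCHARGED
(seat prover-pub-hodgecm2-d2bridge-wb-12-g0-0 = WALL-BREAKER 12).  Sequel of `CorCM/D2Bridge/ConjugateRestTransport.lean` (p372186): its §1
displayed the orientation lemma K1 (`C.IsReflexOfTypeG ῑ₁ Ψ ↔ C.IsReflexOfTypeG ι₁ (bar Ψ)`) as the explicit binder `hK1` because no K1 module had a
farm olean at filing time; d2bridge-prove-3's `CorCM/D2Bridge/ReflexOfTypeConj.lean` (p371989, `isReflexOfTypeG_conj_iff`) now supplies it — its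
`HodgeCM.CMTypeOps.bar` is definitionally the `Literature…CMTypeOps.bar` of `IsConjugateSymplectic.cmType_galConj`.  THEOREMS ONLY (3), explicit
binders, no definition, no instance, no named fact, no `sorry`; nothing landed is edited.  FRAMING: HC_CM is NOT proved; «Δ2 BRIDGE CLOSED» is NOT claimed.
-/
import Summits.HodgeConjecture.CorCM.D2Bridge.ConjugateRestTransport
import Summits.HodgeConjecture.CorCM.D2Bridge.ReflexOfTypeConj
import HarnessLib

/-!
# Δ2 bridge, S-e: the conjugate rest meets the literal admissibility — unconditional form (K1 by import)

* `isReflexOfTypeG_starRingEnd_comp_iff_bar` — K1 in the `Literature` `bar` currency (= `ReflexOfTypeConj.isReflexOfTypeG_conj_iff`, `rfl` on `bar`).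
* `exists_dLiu_of_objOne_conj_of_cmType_eq_bar'`, `exists_dLiu_of_objOne_galConj'` — §1 of `ConjugateRestTransport` with `hK1` discharged.

References: Y. Liu, arXiv:2102.11518 = Camb. J. Math. 9 (2021), Rem. 4.4 (FJcycle.tex l. 1930–1933), Def. 4.5 (2) (l. 1944–1951), proof of
Thm. 4.18 (l. 2246–2253).
-/

set_option autoImplicit false

noncomputable section

open scoped TensorProduct

namespace Summit.HodgeConjecture.CorCM.D2Bridge

open CategoryTheory NumberField
open Literature.AlgebraicGeometry.Motives Literature.AlgebraicGeometry.HodgeTheory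
open Literature.NumberTheory.ComplexMultiplication
open Literature.NumberTheory.ComplexMultiplication.CMTypeOps (bar)
open Literature.NumberTheory.Automorphic Literature.NumberTheory.Automorphic.IdeleClassGroup
open Literature.NumberTheory.Automorphic.Liu2021 Literature.NumberTheory.Automorphic.Liu2021.AppendixC
open Literature.NumberTheory.Automorphic.Liu2021.AppendixC.RestOne
open HodgeCM.Model (LiuCMSide)

variable {L : HodgeCM.CMField}

/-- **K1 in the `Literature` `bar` currency**: `C.IsReflexOfTypeG ῑ₁ Ψ ↔ C.IsReflexOfTypeG ι₁ (bar Ψ)` — d2bridge-prove-3's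
`ReflexOfTypeConj.isReflexOfTypeG_conj_iff`, whose `HodgeCM.CMTypeOps.bar Ψ` is by `rfl` the complement type `CMTypeOps.bar Ψ` of the `Literature`
library (both are `⟨Ψ.1ᶜ, _⟩`). [cite: Liu2021, Remark 4.4 (FJcycle.tex l. 1930–1933)] -/
theorem isReflexOfTypeG_starRingEnd_comp_iff_bar (ι₁ : L →+* ℂ) (C : LiuCMSide) (Ψ : CMType L) :
    C.IsReflexOfTypeG ((starRingEnd ℂ).comp ι₁) Ψ ↔ C.IsReflexOfTypeG ι₁ (bar Ψ) :=
  isReflexOfTypeG_conj_iff ι₁ C Ψ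

/-- **§1.1 of `ConjugateRestTransport`, unconditional**: for any conjugate-symplectic weight-one `ν` with `Φ_ν = bar Φ`, under an instance through
`ῑ₁`, the S1 junction of the `ῑ₁`-presented object yields records admissible in the LITERAL `ι₁`-reading for `Φ`, with the S4 law.
[cite: Liu2021, Def. 4.5 (2) (FJcycle.tex l. 1944–1951), Rem. 4.4 (l. 1930–1933), proof of Thm. 4.18 (l. 2246–2253)] -/
theorem exists_dLiu_of_objOne_conj_of_cmType_eq_bar' [IsGalois ℚ L] (ι₁ : L →+* ℂ)
    {ν : Literature.NumberTheory.Automorphic.IdeleClassGroup L →ₜ* Circle} (hν : IsConjugateSymplectic L ν)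
    (hw : HasWeight L ν 1) (Car : Def45.Carriers L ν) (Φ : CMType L) (hΦ : hν.cmType = bar Φ)
    [inst : Algebra (L : Type) ℂ] (hinst : ∀ x : L, algebraMap (L : Type) ℂ x = ((starRingEnd ℂ).comp ι₁) x)
    (D : ObjOne (AlgHom.id ℚ L) ((starRingEnd ℂ).comp ι₁) hν hw Car)
    (α₀ : ℂ ⊗[ℚ] bettiCohomology (AμC (AlgHom.id ℚ L) ((starRingEnd ℂ).comp ι₁) hν hw Car D).X 1)
    (hα₀ : letI := lineModuleOne (AlgHom.id ℚ L) ((starRingEnd ℂ).comp ι₁) hν hw Car D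
      ∀ s : fieldOfValues L ν,
        (DistribSMul.toLinearMap ℚ (bettiCohomology (AμC (AlgHom.id ℚ L) ((starRingEnd ℂ).comp ι₁) hν hw Car D).X 1) s).baseChange ℂ α₀ =
          algebraMap (fieldOfValues L ν) ℂ s • α₀)
    (hα₀0 : α₀ ≠ 0) :
    ∃ (dLiu : ℚ → LiuCMSide) (u : ∀ q : ℚ, (AμC (AlgHom.id ℚ L) ((starRingEnd ℂ).comp ι₁) hν hw Car D).X ⟶ (dLiu q).A.X),
      (∀ Φ' : CMType L, Φ = Φ' → ∀ q : ℚ, (dLiu q).IsReflexOfTypeG ι₁ Φ') ∧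
      ∀ (q : ℚ) (Y : SchemeOver ℂ) (f : Y ⟶ (AμC (AlgHom.id ℚ L) ((starRingEnd ℂ).comp ι₁) hν hw Car D).X),
        (BettiUniverse.pull (f ≫ u q) 1).baseChange ℂ (dLiu q).α = (q : ℂ) • (BettiUniverse.pull f 1).baseChange ℂ α₀ :=
  exists_dLiu_of_objOne_conj_of_cmType_eq_bar ι₁ (isReflexOfTypeG_starRingEnd_comp_iff_bar ι₁) hν hw Car Φ hΦ hinst D α₀ hα₀ hα₀0

/-- **§1.2 of `ConjugateRestTransport`, unconditional — THE CONJUGATE REST MEETS THE LITERAL ADMISSIBILITY AT FIXED `Φ_μ`**: under the geometric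
instance `ῑ₁`, the S1 junction of the one object of `𝒜(μᶜ)` presented at `ῑ₁` yields `∀ Φ', Φ_μ = Φ' → (dLiu q).IsReflexOfTypeG ι₁ Φ'` (the
`hadm` clause of `HcmS1PinJunction.exists_dLiu_of_objOne ι₁ hμ`) and the S4 law — no displayed hypothesis beyond the objects themselves.
[cite: Liu2021, Rem. 4.4 (FJcycle.tex l. 1930–1933), Def. 4.5 (2) (l. 1944–1951), proof of Thm. 4.18 (l. 2250)] -/
theorem exists_dLiu_of_objOne_galConj' [IsGalois ℚ L] (ι₁ : L →+* ℂ)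
    {μ : Literature.NumberTheory.Automorphic.IdeleClassGroup L →ₜ* Circle} (hμ : IsConjugateSymplectic L μ) (hw : HasWeight L μ 1)
    (Car : Def45.Carriers L (galConj (IsCMField.complexConj L) μ))
    [inst : Algebra (L : Type) ℂ] (hinst : ∀ x : L, algebraMap (L : Type) ℂ x = ((starRingEnd ℂ).comp ι₁) x)
    (D : ObjOne (AlgHom.id ℚ L) ((starRingEnd ℂ).comp ι₁) hμ.galConj hw.galConj_complexConj Car)
    (α₀ : ℂ ⊗[ℚ] bettiCohomology (AμC (AlgHom.id ℚ L) ((starRingEnd ℂ).comp ι₁) hμ.galConj hw.galConj_complexConj Car D).X 1)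
    (hα₀ : letI := lineModuleOne (AlgHom.id ℚ L) ((starRingEnd ℂ).comp ι₁) hμ.galConj hw.galConj_complexConj Car D
      ∀ s : fieldOfValues L (galConj (IsCMField.complexConj L) μ),
        (DistribSMul.toLinearMap ℚ
            (bettiCohomology (AμC (AlgHom.id ℚ L) ((starRingEnd ℂ).comp ι₁) hμ.galConj hw.galConj_complexConj Car D).X 1) s).baseChange ℂ α₀ =
          algebraMap (fieldOfValues L (galConj (IsCMField.complexConj L) μ)) ℂ s • α₀)
    (hα₀0 : α₀ ≠ 0) :
    ∃ (dLiu : ℚ → LiuCMSide)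
      (u : ∀ q : ℚ, (AμC (AlgHom.id ℚ L) ((starRingEnd ℂ).comp ι₁) hμ.galConj hw.galConj_complexConj Car D).X ⟶ (dLiu q).A.X),
      (∀ Φ' : CMType L, hμ.cmType = Φ' → ∀ q : ℚ, (dLiu q).IsReflexOfTypeG ι₁ Φ') ∧
      ∀ (q : ℚ) (Y : SchemeOver ℂ) (f : Y ⟶ (AμC (AlgHom.id ℚ L) ((starRingEnd ℂ).comp ι₁) hμ.galConj hw.galConj_complexConj Car D).X),
        (BettiUniverse.pull (f ≫ u q) 1).baseChange ℂ (dLiu q).α = (q : ℂ) • (BettiUniverse.pull f 1).baseChange ℂ α₀ :=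
  exists_dLiu_of_objOne_galConj ι₁ (isReflexOfTypeG_starRingEnd_comp_iff_bar ι₁) hμ hw Car hinst D α₀ hα₀ hα₀0

end Summit.HodgeConjecture.CorCM.D2Bridge

end
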